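import Literature.Barriers.CriticalPhenomena.TimarLemma42Uniform
import Literature.Barriers.CriticalPhenomena.AmenableInvariantPercolationProofs
import Literature.Probability.Percolation.BondPercolationSymmetry
import Literature.Probability.Percolation.InsertionTolerance
import Literature.Probability.Percolation.DeletionTolerance
import Literature.Barriers.CriticalPhenomena.TimarHeavyClustersErgodic
import Literature.Barriers.CriticalPhenomena.TimarSlabs
import HarnessLib

/-!
# Timár 2006, proof of Thm. 4.3: the graphs `G'(x)`, the boxes `B_x(i; r)`, the event "the open
# component of `x` in `B_x(i; r)` is good", nice clusters, `q > 0`, and the uniform choice of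
# `i` and `r` — PROVED

Barrier catalogue `Literature/Barriers/CriticalPhenomena/`; a brick of the programme behind the
named fact `Timar2006_noInfiniteLightClusters` (Timár's Thm. 4.3, `TimarCriticalNonunimodular.lean`).
Á. Timár, *Percolation on nonunimodular transitive graphs*, Ann. Probab. 34 (2006) 2344–2364,
proof of Thm. 4.3 (pp. 2354–2356 of the journal = pp. 10–13 of arXiv:math/0702875):

> "Fix some `o'` below `o` which is connected to `o` by some long edge. Consider the subgraph of
> `G` induced by the vertices on level `ℓ_1` and below it and let `G'(o) = G'` be the union of this
> subgraph and the long edge from `o` to `o'`. One can define `G'(x)`, for any `x ∈ V(G)`, as the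
> image of `G'(o)` by some (arbitrarily fixed) automorphism of `G` that takes `o` to `x`. …
> Given an `x` in some `G(ℓ_{j+1}, ℓ_j]`, the vertex `x'` … and `r, i ≥ 1`, define
> `B_x(i; r) := B(x; r) ∩ G'(x) ∩ G(ℓ_{j+i}, ℓ_j]`. We say that a vertex `v` in `B_x(i; r) ∖ {x, x'}`
> belongs to the side boundary of `B_x(i; r)` if there is some edge `{v, w}` such that `w` is above
> `ℓ_{j+i}` but not in `B_x(i; r)`. Given `k ∈ ℕ`, we say that the open component of `x` in
> `B_x(i; r)` is *good* if it contains at least `k` vertices in `G(ℓ_{j+i}, ℓ_{j+i-1}]` and the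
> side boundary of `B_x(i; r)` is disjoint from `C`."

## What is here (all PROVED; weights `w = autWeight G o`, `Δ = minNbrWeight G o`)

* `ballSet G x r` — the ball `B(x, r)` (the tree's `ballF`, as a set), its walks description,
  finiteness and automorphism-equivariance (`image_ballSet`).
* `lowSet G o x = {v : w(v) ≤ Δ w(x)}` ("level `ℓ_1` and below", seen from `x`) and
  `lowerGraph G o x x'` — Timár's `G'(x)`: the steps of `G` inside `lowSet x` together with the
  long edge `{x, x'}`.
* `boxSet G o x A r = {v : A < w(v)} ∩ B(x, r)` and `boxStepGraph` — the box `B_x(i; r)` with its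
  bottom at the absolute weight threshold `A` (`A = Δ^{j+i+1}` in the grid notation; the printed
  `G(ℓ_{j+i}, ℓ_j]` is `{Δ^{j+i} < w ≤ Δ^j}`, and the indices of the printed proof are shifted
  by one so that the bottom slab of the box is where the children live, see
  `TimarLemma42Uniform.lean`), `boxCluster` — "the open component of `x` in `B_x(i; r)`",
  `BoxSealed` — "the side boundary is disjoint from `C`", read with OPEN edges (a vertex of the
  component other than `x` has no open edge to a vertex of weight `> A` outside the box; with all
  edges of `G` the condition could never hold, every vertex having a neighbour one long edge above
  it, `exists_adj_mul_autWeight_eq`), and `boxGood G o x x' A r k` — "good": at least `k`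
  vertices of the component in the bottom window `(A, A Δ⁻¹]` (`wwindow`) and sealed. We do not
  exempt `x'` from the sealing condition (the printed definition exempts `{x, x'}`); this only
  shrinks the event, is still implied by niceness (second half of this file), and makes the components of two
  good boxes of one generation disjoint outright (`boxCluster_disjoint_of_sealed`: the printed
  "these components are disjoint unless `x' = y'`" without the exception, so that the random
  choice of "parental" vertices is not needed).
* `boxEdges` — the finite set of edges the event `boxGood` depends on
  (`determinedBy_boxGood`, `boxEdges_finite`), all of whose edges have both endpoints of weight
  `> A` and one endpoint of weight `≤ Δ w(x)` (`boxEdges_weight`): "by definition, the edge sets in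
  `B_x` and `B_y` are disjoint whenever `x ∈ G(ℓ_{gi+1}, ℓ_{gi}]`, `y ∈ G(ℓ_{g'i+1}, ℓ_{g'i}]` and
  `g ≠ g'`", and they lie inside `B(x, r+1)` ("The number of different `B_y`'s that intersect a
  fixed `B_x` is at most `|B(x, 2r)| =: σ`").
* measurability of `boxGood` (`measurableSet_boxGood`).

## Second half of the file: nice clusters, `q > 0`, and the uniform choice of `i` and `r`

Timár, proof of Thm. 4.3, p. 2355:

> "We say that `C(x)` is *nice* if `C(x) = C(x)|_{G'(x)}`. Let `F(x)` be the event that `C(x)` is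
> infinite, light and nice. Note that the probability of `F(x) =: F` is independent of `x` … By
> insertion and deletion tolerance and the assumption that there are light clusters, we have
> `q := P[F] > 0`. To see this, consider the event that `o'` is an uppermost vertex of a light
> cluster, insert the edge between `o` and `o'` and delete all other edges incident to `o`. In the
> resulting configurations (a set of positive probability), `C(o)` is nice. …
> From Lemma 4.2, we know that given the event that `C(o)` is nice and light, with probability
> arbitrarily close to `1`, `|C(o) ∩ G(ℓ_{i+1}, ℓ_i]| ≥ k` if `i` is sufficiently large. Hence, for
> any `k`, there exist an `i` and an `r ∈ ℕ` such that the open component of `o` in `B_o(i; r)` is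
> good with probability `> q/2`. (First, we choose `i`, using Lemma 4.2, to satisfy the first
> property for being good. Then we choose `r` to satisfy the second property. This can always be
> done since the intersection of a light cluster with `G(ℓ_{j+i}, ℓ_j]` is finite by definition
> and thus the probability that it intersects a large sphere around `o` can be made arbitrarily
> small.) Clearly, there is also a uniform choice, so that `B_x(i; r)` is good for any `x` below
> `o`."

## What is here (all PROVED)

* `IsNice G o x x' ω` — niceness, in the closed-edge form "the only open edge of `G` at `x` is
  the long edge `{x, x'}`, and no vertex of `C(x) ∖ {x}` has an open edge to a vertex of weight
  `> Δ w(x)` other than `x`" (so that `C(x) = C(x)|_{G'(x)}`), and `niceEvent G o x x'` — the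
  event `F(x)`; `measurableSet_niceEvent`.
* `niceEvent_pos_of_lightCluster` — **`q > 0`**: if with positive probability some open cluster
  is infinite and light, then `P[F(o)] > 0` (`0 < p < 1`): an uppermost vertex of an infinite light
  cluster exists (`exists_uppermost`), is carried to `o'` by an automorphism
  (`measure_uppermostEvent_map`), and then deletion of the edges at `o` followed by insertion of
  `{o, o'}` (`DeletionTolerance.lean`, `InsertionTolerance.lean`) produces `F(o)`
  (`openEdges_closeEdges_mem_niceEvent`).
* `boxGood_of_nice` — on a nice configuration, if the cluster of `x` inside `{w > A}` has `≥ k`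
  vertices in the window `(A, A Δ⁻¹]` and the vertices of `C(x)` of weight `> A` lie in `B(x, r)`,
  then the box of `x` with bottom `A` and radius `r` is good.
* `tendsto_measure_light_diff_containedEvent` — `P[C(x) light, C(x) ∩ {w ≥ B} ⊄ B(x, r)] → 0` as
  `r → ∞` for `B ≠ 0` (a light cluster meets `{w ≥ B}` in a finite set).
* `exists_depth_radius_boxGood_ge` — **the uniform choice**: for every `k` there are `I ≥ 1` and
  `r ≥ 1` such that `P[boxGood o o' a r k] ≥ P[F(o)]/2` for EVERY relative threshold
  `a ∈ [Δ^{I+1}, Δ^I)` (uniform Lemma 4.2, `TimarLemma42Uniform.lean`, plus the two facts above).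

## References

* Á. Timár, Ann. Probab. 34 (2006) 2344–2364 (arXiv:math/0702875), proof of Thm. 4.3:
  `G'(x)`, `B_x(i; r)`, side boundary, "good", "these components are disjoint unless `x' = y'`",
  "the edge sets in `B_x` and `B_y` are disjoint whenever … `g ≠ g'`", `σ = |B(x, 2r)|`;
  p. 2355 (nice, `F(x)`, `q > 0`, the choice of `i` and `r`, "uniform choice"). [Timar2006]
-/

noncomputable section

namespace Literature.Barriers.CriticalPhenomena

open _root_.MeasureTheory _root_.Filter Literature.Probability.Percolation
open scoped _root_.ENNReal _root_.Topology

variable {V : Type*}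

/-! ### Balls `B(x, r)` as sets -/

section Ball

variable (G : SimpleGraph V) [G.LocallyFinite]

open Classical in
/-- The ball `B(x, r)` of the graph metric as a set (the tree's `ballF`). [folklore] -/
def ballSet (x : V) (r : ℕ) : Set V := ↑(ballF G x r)

variable {G}

/-- `y ∈ B(x, r)` iff some walk of length `≤ r` joins `x` to `y`. [folklore] -/
theorem mem_ballSet_iff {x y : V} {r : ℕ} : y ∈ ballSet G x r ↔ ∃ p : G.Walk x y, p.length ≤ r := by
  classical
  unfold ballSet
  rw [Finset.mem_coe]
  exact ⟨fun h => exists_walk_of_mem_ballF h, fun ⟨p, hp⟩ => mem_ballF_of_walk p hp⟩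

variable (G) in
/-- Balls are finite (locally finite graph). [folklore] -/
theorem ballSet_finite (x : V) (r : ℕ) : (ballSet G x r).Finite := Finset.finite_toSet _

variable (G) in
/-- `x ∈ B(x, r)`. [folklore] -/
theorem mem_ballSet_self (x : V) (r : ℕ) : x ∈ ballSet G x r :=
  mem_ballSet_iff.2 ⟨SimpleGraph.Walk.nil, Nat.zero_le _⟩

/-- Balls grow with the radius. [folklore] -/
theorem ballSet_mono (x : V) {r s : ℕ} (h : r ≤ s) : ballSet G x r ⊆ ballSet G x s := by
  intro y hy
  obtain ⟨p, hp⟩ := mem_ballSet_iff.1 hy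
  exact mem_ballSet_iff.2 ⟨p, hp.trans h⟩

/-- A neighbour of a vertex of `B(x, r)` lies in `B(x, r+1)`. [folklore] -/
theorem mem_ballSet_succ_of_adj {x u v : V} {r : ℕ} (hu : u ∈ ballSet G x r) (h : G.Adj u v) :
    v ∈ ballSet G x (r + 1) := by
  obtain ⟨p, hp⟩ := mem_ballSet_iff.1 hu
  exact mem_ballSet_iff.2 ⟨p.concat h, by rw [SimpleGraph.Walk.length_concat]; omega⟩

/-- The ball relation is symmetric. [folklore] -/
theorem mem_ballSet_comm {x y : V} {r : ℕ} : y ∈ ballSet G x r ↔ x ∈ ballSet G y r := by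
  constructor
  · intro h
    obtain ⟨p, hp⟩ := mem_ballSet_iff.1 h
    exact mem_ballSet_iff.2 ⟨p.reverse, by rw [SimpleGraph.Walk.length_reverse]; exact hp⟩
  · intro h
    obtain ⟨p, hp⟩ := mem_ballSet_iff.1 h
    exact mem_ballSet_iff.2 ⟨p.reverse, by rw [SimpleGraph.Walk.length_reverse]; exact hp⟩

/-- Triangle inequality for balls. [folklore] -/
theorem mem_ballSet_add {x y z : V} {r s : ℕ} (hy : y ∈ ballSet G x r) (hz : z ∈ ballSet G y s) :
    z ∈ ballSet G x (r + s) := by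
  obtain ⟨p, hp⟩ := mem_ballSet_iff.1 hy
  obtain ⟨q, hq⟩ := mem_ballSet_iff.1 hz
  exact mem_ballSet_iff.2 ⟨p.append q, by rw [SimpleGraph.Walk.length_append]; omega⟩

/-- Automorphisms map balls onto balls: `γ B(x, r) = B(γ x, r)`. [folklore] -/
theorem image_ballSet (γ : G ≃g G) (x : V) (r : ℕ) :
    (γ : V → V) '' ballSet G x r = ballSet G (γ x) r := by
  ext v
  simp only [Set.mem_image, mem_ballSet_iff]
  constructor
  · rintro ⟨y, ⟨p, hp⟩, rfl⟩
    exact ⟨p.map γ.toEmbedding.toHom, by rw [SimpleGraph.Walk.length_map]; exact hp⟩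
  · rintro ⟨p, hp⟩
    refine ⟨γ.symm v, ⟨(p.map γ.symm.toEmbedding.toHom).copy (γ.symm_apply_apply x) rfl, ?_⟩,
      γ.apply_symm_apply v⟩
    rw [SimpleGraph.Walk.length_copy, SimpleGraph.Walk.length_map]; exact hp

/-- Membership transported by an automorphism: `γ v ∈ B(γ x, r) ↔ v ∈ B(x, r)`. [folklore] -/
theorem mem_ballSet_map_iff (γ : G ≃g G) {x v : V} {r : ℕ} :
    γ v ∈ ballSet G (γ x) r ↔ v ∈ ballSet G x r := by
  rw [← image_ballSet γ x r, γ.injective.mem_set_image]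

/-- On a transitive graph all balls of one radius have the same number of vertices. [folklore] -/
theorem ncard_ballSet_eq (htr : IsGraphTransitive G) (x y : V) (r : ℕ) :
    (ballSet G x r).ncard = (ballSet G y r).ncard := by
  obtain ⟨γ, rfl⟩ := htr x y
  rw [← image_ballSet γ x r, Set.ncard_image_of_injective _ γ.injective]

end Ball

/-! ### `G'(x)`: the lower graph with the long edge `{x, x'}` -/

section LowerGraph

variable (G : SimpleGraph V) [G.LocallyFinite] (o : V)

/-- "Level `ℓ_1` and below", seen from `x`: the vertices of weight `≤ Δ w(x)`.
[cite: Timar2006, §4 (proof of Thm. 4.3: the subgraph induced by ℓ_1 and the levels below)] -/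
def lowSet (x : V) : Set V := {v | autWeight G o v ≤ minNbrWeight G o * autWeight G o x}

/-- **Timár's `G'(x)`**: the steps of `G` inside `lowSet x` together with the long edge
`{x, x'}` ("the union of this subgraph and the long edge from `o` to `o'`", transported to `x`).
[cite: Timar2006, §4 (proof of Thm. 4.3: G'(o), G'(x))] -/
def lowerGraph (x x' : V) : SimpleGraph V where
  Adj u v := G.Adj u v ∧ ((u ∈ lowSet G o x ∧ v ∈ lowSet G o x) ∨ s(u, v) = s(x, x'))
  symm.symm _ _ h := ⟨h.1.symm, h.2.imp (fun h' => ⟨h'.2, h'.1⟩) fun h' => Sym2.eq_swap.trans h'⟩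
  loopless.irrefl _ h := h.1.ne rfl

variable {G o}

/-- Adjacency in `G'(x)`, unfolded. [folklore] -/
@[simp] theorem lowerGraph_adj {x x' u v : V} :
    (lowerGraph G o x x').Adj u v ↔
      G.Adj u v ∧ ((u ∈ lowSet G o x ∧ v ∈ lowSet G o x) ∨ s(u, v) = s(x, x')) :=
  Iff.rfl

/-- `G'(x)` is a subgraph of `G`. [folklore] -/
theorem lowerGraph_le (x x' : V) : lowerGraph G o x x' ≤ G := fun _ _ h => h.1

/-- `x ∉ lowSet x`: `Δ w(x) < w(x)` on a transitive nonunimodular graph. [folklore] -/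
theorem not_mem_lowSet_self (hconn : G.Connected) (htr : IsGraphTransitive G)
    (hU : ¬ IsGraphUnimodular G) (x : V) : x ∉ lowSet G o x := by
  show ¬ autWeight G o x ≤ minNbrWeight G o * autWeight G o x
  rw [not_le]
  calc minNbrWeight G o * autWeight G o x < 1 * autWeight G o x := by
        exact ENNReal.mul_lt_mul_left (autWeight_ne_zero G hconn o x)
          (autWeight_ne_top G hconn o x) (minNbrWeight_lt_one hconn htr hU o)
    _ = autWeight G o x := one_mul _

/-- A step of `G'(x)` from a vertex which is `x` or low lands on `x` or a low vertex, provided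
`x'` is low. [folklore] -/
theorem lowerGraph_adj_mem {x x' u v : V} (hx' : x' ∈ lowSet G o x)
    (h : (lowerGraph G o x x').Adj u v) : v = x ∨ v ∈ lowSet G o x := by
  rcases h.2 with ⟨-, hv⟩ | he
  · exact Or.inr hv
  · rcases Sym2.eq_iff.1 he with ⟨-, rfl⟩ | ⟨-, rfl⟩
    · exact Or.inr hx'
    · exact Or.inl rfl

end LowerGraph

/-! ### The boxes `B_x(i; r)`, their open components, "sealed" and "good" -/

section Box

variable (G : SimpleGraph V) [G.LocallyFinite] (o : V)

/-- The vertex set of the box hanging from `x` down to the weight threshold `A`, within radius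
`r`: `{v : A < w(v)} ∩ B(x, r)` (the part of `B_x(i; r) = B(x; r) ∩ G'(x) ∩ G(ℓ_{j+i}, ℓ_j]`
that the step graph `boxStepGraph` can reach). [cite: Timar2006, §4 (proof of Thm. 4.3: B_x(i; r))] -/
def boxSet (x : V) (A : ℝ≥0∞) (r : ℕ) : Set V := {v | A < autWeight G o v} ∩ ballSet G x r

/-- The step graph of the box: steps of `G'(x)` inside `boxSet`.
[cite: Timar2006, §4 (proof of Thm. 4.3: B_x(i; r))] -/
def boxStepGraph (x x' : V) (A : ℝ≥0∞) (r : ℕ) : SimpleGraph V :=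
  withinGraph (lowerGraph G o x x') (boxSet G o x A r)

/-- "The open component of `x` in `B_x(i; r)`". [cite: Timar2006, §4 (proof of Thm. 4.3)] -/
def boxCluster (x x' : V) (A : ℝ≥0∞) (r : ℕ) (ω : BondConfig V) : Set V :=
  openClusterIn (boxStepGraph G o x x' A r) ω x

/-- **Sealed** ("the side boundary of `B_x(i; r)` is disjoint from `C`", with open edges): every
open edge of `G` from a vertex `u ≠ x` of the component leads either into the box at a low vertex
(or back to `x`), or down to weight `≤ A`. [cite: Timar2006, §4 (proof of Thm. 4.3: side boundary disjoint from C)] -/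
def BoxSealed (x x' : V) (A : ℝ≥0∞) (r : ℕ) (ω : BondConfig V) : Prop :=
  ∀ u ∈ boxCluster G o x x' A r ω, u ≠ x → ∀ v, G.Adj u v → s(u, v) ∈ ω →
    (v ∈ boxSet G o x A r ∧ (v ∈ lowSet G o x ∨ v = x)) ∨ autWeight G o v ≤ A

/-- **"Good"**: the open component of `x` in the box has at least `k` vertices in the bottom
window `(A, A Δ⁻¹]` and is sealed. [cite: Timar2006, §4 (proof of Thm. 4.3: definition of good)] -/
def boxGood (x x' : V) (A : ℝ≥0∞) (r k : ℕ) : Set (BondConfig V) :=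
  {ω | (k : ℕ∞) ≤ (boxCluster G o x x' A r ω ∩ wwindow G o A).encard ∧ BoxSealed G o x x' A r ω}

variable {G o}

/-- `x` lies in its box as soon as `A < w(x)`. [folklore] -/
theorem mem_boxSet_self {x : V} {A : ℝ≥0∞} (hA : A < autWeight G o x) (r : ℕ) :
    x ∈ boxSet G o x A r :=
  ⟨hA, mem_ballSet_self G x r⟩

/-- The component lies in the box (given `x` does). [folklore] -/
theorem boxCluster_subset_boxSet {x x' : V} {A : ℝ≥0∞} {r : ℕ} (hx : x ∈ boxSet G o x A r)
    (ω : BondConfig V) : boxCluster G o x x' A r ω ⊆ boxSet G o x A r :=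
  openClusterIn_withinGraph_subset hx ω

/-- The component lies in the open cluster of `x`. [folklore] -/
theorem boxCluster_subset_openCluster (x x' : V) (A : ℝ≥0∞) (r : ℕ) (ω : BondConfig V) :
    boxCluster G o x x' A r ω ⊆ openCluster ω x :=
  openClusterIn_subset_openCluster _ ω x

/-- Along a walk of the constrained open graph starting at `x` or at a low vertex, every vertex
is `x` or low (for `x'` low). [folklore] -/
theorem eq_or_mem_lowSet_of_walk {x x' : V} {A : ℝ≥0∞} {r : ℕ} (hx' : x' ∈ lowSet G o x)
    {ω : BondConfig V} :
    ∀ {a b : V} (_ : (openGraph ω ⊓ boxStepGraph G o x x' A r).Walk a b),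
      (a = x ∨ a ∈ lowSet G o x) → (b = x ∨ b ∈ lowSet G o x)
  | _, _, .nil, h => h
  | _, _, .cons hadj q, _ => eq_or_mem_lowSet_of_walk hx' q (lowerGraph_adj_mem hx' hadj.2.1)

/-- **A vertex of the component other than `x` is low** (for `x'` low): it is entered by a step of
`G'(x)`, i.e. inside `lowSet x` or along the long edge to `x'`. [cite: Timar2006, §4 (proof of Thm. 4.3: G'(x))] -/
theorem mem_lowSet_of_mem_boxCluster {x x' : V} {A : ℝ≥0∞} {r : ℕ} (hx' : x' ∈ lowSet G o x)
    {ω : BondConfig V} {u : V} (hu : u ∈ boxCluster G o x x' A r ω) (hne : u ≠ x) :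
    u ∈ lowSet G o x := by
  rw [boxCluster, mem_openClusterIn_iff] at hu
  obtain ⟨p⟩ := hu
  exact (eq_or_mem_lowSet_of_walk hx' p (Or.inl rfl)).resolve_left hne

/-- A vertex which is neither `x` nor low is not in the component of `x`'s box. [folklore] -/
theorem not_mem_boxCluster {x x' : V} {A : ℝ≥0∞} {r : ℕ} (hx' : x' ∈ lowSet G o x) {y : V}
    (hyx : y ≠ x) (hy : y ∉ lowSet G o x) (ω : BondConfig V) : y ∉ boxCluster G o x x' A r ω :=
  fun h => hy (mem_lowSet_of_mem_boxCluster hx' h hyx)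

/-- Core of the disjointness argument: a constrained open walk of `y`'s box ending at `y` cannot
start at a vertex `≠ x` of a SEALED component of `x`'s box (same threshold `A`), when `y` is
neither `x` nor low for `x` and `x` is neither `y` nor low for `y`.
[cite: Timar2006, §4 (proof of Thm. 4.3: "these components are disjoint unless x' = y'")] -/
theorem false_of_walk_of_sealed (hconn : G.Connected) (htr : IsGraphTransitive G)
    (hU : ¬ IsGraphUnimodular G) {x x' y y' : V} {A : ℝ≥0∞} {r s : ℕ}
    (hx' : x' ∈ lowSet G o x) (hy' : y' ∈ lowSet G o y) (hxA : x ∈ boxSet G o x A r)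
    (hyx : y ≠ x) (hy : y ∉ lowSet G o x) (hxy : x ≠ y) (hx : x ∉ lowSet G o y)
    {ω : BondConfig V} (hseal : BoxSealed G o x x' A r ω) :
    ∀ {c : V} (_ : (openGraph ω ⊓ boxStepGraph G o y y' A s).Walk c y),
      c ∈ boxCluster G o x x' A r ω → c ≠ x → False
  | _, .nil, hc, hcx => not_mem_boxCluster hx' hyx hy ω hc
  | c, .cons (v := d) hadj q, hc, hcx => by
    have hopen : s(c, d) ∈ ω := ((openGraph_adj ω c d).1 hadj.1).1
    have hG : G.Adj c d := hadj.2.1.1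
    have hdA : A < autWeight G o d := hadj.2.2.2.1
    -- `d` lies on a walk to `y`, hence in the component of `y`'s box
    have hdy : d ∈ boxCluster G o y y' A s ω := by
      rw [boxCluster, mem_openClusterIn_iff]
      exact ⟨q.reverse⟩
    rcases hseal c hc hcx d hG hopen with ⟨hdbox, hdlow | hdx⟩ | hdle
    · -- `d` is a low vertex of `x`'s box: the step is a step of `x`'s box graph, recurse
      have hclow : c ∈ lowSet G o x := mem_lowSet_of_mem_boxCluster hx' hc hcx
      have hd : d ∈ boxCluster G o x x' A r ω :=
        mem_openClusterIn_of_adj hc ⟨⟨hG, Or.inl ⟨hclow, hdlow⟩⟩,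
          boxCluster_subset_boxSet hxA ω hc, hdbox⟩ hopen
      exact false_of_walk_of_sealed hconn htr hU hx' hy' hxA hyx hy hxy hx hseal q hd
        fun h => not_mem_lowSet_self hconn htr hU x (h ▸ hdlow)
    · -- `d = x` would put `x` into the component of `y`'s box
      subst hdx
      exact not_mem_boxCluster hy' hxy hx ω hdy
    · exact absurd hdA (not_lt.2 hdle)

/-- **The components of two sealed boxes of one generation are disjoint** ("if the open
components of `x` in `B_x` and `y` in `B_y` are good, then these components are disjoint
[unless `x' = y'`]" — here without exception, `x'` not being exempted from the sealing): for
boxes with a common bottom threshold `A` hanging from `x ≠ y`, neither of which is low for the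
other (e.g. both in one slab), sealedness of `x`'s component alone forces disjointness.
[cite: Timar2006, §4 (proof of Thm. 4.3: "these components are disjoint unless x' = y'")] -/
theorem boxCluster_disjoint_of_sealed (hconn : G.Connected) (htr : IsGraphTransitive G)
    (hU : ¬ IsGraphUnimodular G) {x x' y y' : V} {A : ℝ≥0∞} {r s : ℕ}
    (hx' : x' ∈ lowSet G o x) (hy' : y' ∈ lowSet G o y) (hxA : x ∈ boxSet G o x A r)
    (hxy : x ≠ y) (hy : y ∉ lowSet G o x) (hx : x ∉ lowSet G o y)
    {ω : BondConfig V} (hseal : BoxSealed G o x x' A r ω) :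
    Disjoint (boxCluster G o x x' A r ω) (boxCluster G o y y' A s ω) := by
  rw [Set.disjoint_left]
  intro v hvx hvy
  have hvy' := hvy
  rw [boxCluster, mem_openClusterIn_iff] at hvy'
  obtain ⟨p⟩ := hvy'.symm
  refine false_of_walk_of_sealed hconn htr hU hx' hy' hxA hxy.symm hy hxy hx hseal p hvx ?_
  rintro rfl
  exact not_mem_boxCluster hy' hxy hx ω hvy

/-! ### The edges a good box depends on -/

/-- The edges the event `boxGood G o x x' A r k` depends on: the edges of the box graph, and
the edges of `G` from a low vertex of the box to a vertex of weight `> A` that is not a low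
vertex of the box or `x` (the possible open exits forbidden by sealedness).
[cite: Timar2006, §4 (proof of Thm. 4.3: the edge sets in B_x)] -/
def boxEdges (G : SimpleGraph V) [G.LocallyFinite] (o : V) (x x' : V) (A : ℝ≥0∞) (r : ℕ) :
    Set (Sym2 V) :=
  (boxStepGraph G o x x' A r).edgeSet ∪
    {e | ∃ u v : V, e = s(u, v) ∧ u ∈ boxSet G o x A r ∧ u ∈ lowSet G o x ∧ G.Adj u v ∧
      A < autWeight G o v ∧ ¬ (v ∈ boxSet G o x A r ∧ (v ∈ lowSet G o x ∨ v = x))}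

/-- Configurations agreeing on a set agree on every subset. [folklore] -/
theorem inter_eq_inter_of_subset {ω ω' : BondConfig V} {D E : Set (Sym2 V)}
    (h : ω ∩ D = ω' ∩ D) (hE : E ⊆ D) : ω ∩ E = ω' ∩ E := by
  ext e
  constructor
  · rintro ⟨he, heE⟩
    exact ⟨((Set.ext_iff.1 h e).1 ⟨he, hE heE⟩).1, heE⟩
  · rintro ⟨he, heE⟩
    exact ⟨((Set.ext_iff.1 h e).2 ⟨he, hE heE⟩).1, heE⟩

/-- The component of the box only depends on the edges of the box graph. [folklore] -/
theorem boxCluster_eq_of_inter_eq {x x' : V} {A : ℝ≥0∞} {r : ℕ} {ω ω' : BondConfig V}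
    (h : ω ∩ boxEdges G o x x' A r = ω' ∩ boxEdges G o x x' A r) :
    boxCluster G o x x' A r ω = boxCluster G o x x' A r ω' := by
  rw [boxCluster, boxCluster, ← openClusterIn_inter_edgeSet _ ω, ← openClusterIn_inter_edgeSet _ ω',
    inter_eq_inter_of_subset h Set.subset_union_left]

/-- Sealedness transfers between configurations agreeing on `boxEdges`. [folklore] -/
theorem boxSealed_of_inter_eq {x x' : V} {A : ℝ≥0∞} {r : ℕ} (hx' : x' ∈ lowSet G o x)
    (hxA : x ∈ boxSet G o x A r) {ω ω' : BondConfig V}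
    (h : ω ∩ boxEdges G o x x' A r = ω' ∩ boxEdges G o x x' A r)
    (hseal : BoxSealed G o x x' A r ω) : BoxSealed G o x x' A r ω' := by
  intro u hu hux v hG hopen'
  rw [← boxCluster_eq_of_inter_eq h] at hu
  by_cases hvA : autWeight G o v ≤ A
  · exact Or.inr hvA
  by_cases hcond : v ∈ boxSet G o x A r ∧ (v ∈ lowSet G o x ∨ v = x)
  · exact Or.inl hcond
  -- otherwise the edge is one of `boxEdges`, so it is open in `ω` too
  have he : s(u, v) ∈ boxEdges G o x x' A r :=
    Or.inr ⟨u, v, rfl, boxCluster_subset_boxSet hxA ω hu, mem_lowSet_of_mem_boxCluster hx' hu hux,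
      hG, not_le.1 hvA, hcond⟩
  have hopen : s(u, v) ∈ ω := ((Set.ext_iff.1 h _).2 ⟨hopen', he⟩).1
  exact hseal u hu hux v hG hopen

/-- **The good event is determined by the edges `boxEdges`.** [cite: Timar2006, §4 (proof of Thm. 4.3: the edge sets in B_x)] -/
theorem determinedBy_boxGood {x x' : V} {A : ℝ≥0∞} {r : ℕ} (hx' : x' ∈ lowSet G o x)
    (hxA : x ∈ boxSet G o x A r) (k : ℕ) :
    DeterminedBy (boxGood G o x x' A r k) (boxEdges G o x x' A r) := by
  rw [determinedBy_iff]
  intro ω ω' h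
  simp only [boxGood, Set.mem_setOf_eq, boxCluster_eq_of_inter_eq h]
  exact and_congr_right fun _ =>
    ⟨boxSealed_of_inter_eq hx' hxA h, boxSealed_of_inter_eq hx' hxA h.symm⟩

/-- Every edge of `boxEdges` joins two vertices of `B(x, r+1)`. [folklore] -/
theorem boxEdges_subset (x x' : V) (A : ℝ≥0∞) (r : ℕ) :
    boxEdges G o x x' A r ⊆
      (fun q : V × V => s(q.1, q.2)) '' (ballSet G x (r + 1) ×ˢ ballSet G x (r + 1)) := by
  have hr : ballSet G x r ⊆ ballSet G x (r + 1) := ballSet_mono x (Nat.le_succ r)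
  rintro e (he | ⟨u, v, rfl, hu, -, hG, -, -⟩)
  · induction e using Sym2.ind with
    | h u v =>
      have hadj := (SimpleGraph.mem_edgeSet _).1 he
      exact ⟨(u, v), ⟨hr hadj.2.1.2, hr hadj.2.2.2⟩, rfl⟩
  · exact ⟨(u, v), ⟨hr hu.2, mem_ballSet_succ_of_adj hu.2 hG⟩, rfl⟩

/-- `boxEdges` is finite. [folklore] -/
theorem boxEdges_finite (x x' : V) (A : ℝ≥0∞) (r : ℕ) : (boxEdges G o x x' A r).Finite :=
  (((ballSet_finite G x (r + 1)).prod (ballSet_finite G x (r + 1))).image _).subset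
    (boxEdges_subset x x' A r)

/-- **Weights on the edges of `boxEdges`**: both endpoints have weight `> A`, and one endpoint is
low (weight `≤ Δ w(x)`), provided `x'` is low and `x` lies in its box. [cite: Timar2006, §4 (proof of Thm. 4.3: the edge sets of boxes of different generations are disjoint)] -/
theorem boxEdges_weight {x x' : V} {A : ℝ≥0∞} {r : ℕ} (hx' : x' ∈ lowSet G o x)
    {e : Sym2 V} (he : e ∈ boxEdges G o x x' A r) :
    (∀ u ∈ e, A < autWeight G o u) ∧ ∃ u ∈ e, u ∈ lowSet G o x := by
  rcases he with he | ⟨u, v, rfl, hu, hulow, -, hvA, -⟩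
  · induction e using Sym2.ind with
    | h u v =>
      have hadj := (SimpleGraph.mem_edgeSet _).1 he
      refine ⟨fun w hw => ?_, ?_⟩
      · rcases Sym2.mem_iff.1 hw with rfl | rfl
        · exact hadj.2.1.1
        · exact hadj.2.2.1
      · rcases hadj.1.2 with ⟨hul, -⟩ | hxx
        · exact ⟨u, Sym2.mem_mk_left u v, hul⟩
        · exact ⟨x', by rw [hxx]; exact Sym2.mem_mk_right x x', hx'⟩
  · refine ⟨fun w hw => ?_, ⟨u, Sym2.mem_mk_left u v, hulow⟩⟩
    rcases Sym2.mem_iff.1 hw with rfl | rfl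
    · exact hu.1
    · exact hvA

end Box

/-! ### Measurability -/

section Measurable

variable {G : SimpleGraph V} [G.LocallyFinite] {o : V} [Countable V]

/-- `{y ∈ boxCluster}` is measurable. [folklore] -/
theorem measurableSet_mem_boxCluster (x x' : V) (A : ℝ≥0∞) (r : ℕ) (y : V) :
    MeasurableSet {ω | y ∈ boxCluster G o x x' A r ω} :=
  measurableSet_openConnVia _ x y

/-- The counting event `{k ≤ |C ∩ W|}` for a random set `C ω` inside a finite set `T` with
measurable memberships is measurable: it is the union over finite `B ⊆ T`, `|B| ≥ k`, of
`{B ⊆ C ω}`. [folklore] -/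
theorem measurableSet_le_encard_inter {C : BondConfig V → Set V} {T W : Set V} (hT : T.Finite)
    (hCT : ∀ ω, C ω ⊆ T) (hC : ∀ y, MeasurableSet {ω | y ∈ C ω}) (k : ℕ) :
    MeasurableSet {ω | (k : ℕ∞) ≤ (C ω ∩ W).encard} := by
  classical
  have heq : {ω | (k : ℕ∞) ≤ (C ω ∩ W).encard} =
      ⋃ B ∈ {B : Finset V | ↑B ⊆ T ∩ W ∧ k ≤ B.card}, {ω | (↑B : Set V) ⊆ C ω} := by
    ext ω
    simp only [Set.mem_setOf_eq, Set.mem_iUnion, exists_prop]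
    constructor
    · intro hk
      have hfin : (C ω ∩ W).Finite := hT.subset (Set.inter_subset_left.trans (hCT ω))
      refine ⟨hfin.toFinset, ⟨?_, ?_⟩, ?_⟩
      · rw [Set.Finite.coe_toFinset]
        exact Set.inter_subset_inter_left _ (hCT ω)
      · rw [hfin.encard_eq_coe_toFinset_card] at hk
        exact_mod_cast hk
      · rw [Set.Finite.coe_toFinset]
        exact Set.inter_subset_left
    · rintro ⟨B, ⟨hBT, hBk⟩, hBC⟩
      calc (k : ℕ∞) ≤ B.card := by exact_mod_cast hBk
        _ = (↑B : Set V).encard := (Set.encard_coe_eq_coe_finsetCard B).symm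
        _ ≤ (C ω ∩ W).encard :=
          Set.encard_le_encard (Set.subset_inter hBC fun v hv => (hBT hv).2)
  rw [heq]
  refine MeasurableSet.biUnion (Set.to_countable _) fun B _ => ?_
  have : {ω | (↑B : Set V) ⊆ C ω} = ⋂ y ∈ B, {ω | y ∈ C ω} := by
    ext ω
    simp only [Set.mem_setOf_eq, Set.mem_iInter, Set.subset_def, Finset.mem_coe]
  rw [this]
  exact Finset.measurableSet_biInter B fun y _ => hC y

/-- The sealedness event is measurable. [folklore] -/
theorem measurableSet_boxSealed (x x' : V) (A : ℝ≥0∞) (r : ℕ) :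
    MeasurableSet {ω | BoxSealed G o x x' A r ω} := by
  have heq : {ω | BoxSealed G o x x' A r ω} =
      ⋂ u : V, ⋂ v : V, {ω | u ∈ boxCluster G o x x' A r ω → s(u, v) ∈ ω →
        (u ≠ x → G.Adj u v →
          (v ∈ boxSet G o x A r ∧ (v ∈ lowSet G o x ∨ v = x)) ∨ autWeight G o v ≤ A)} := by
    ext ω
    simp only [BoxSealed, Set.mem_setOf_eq, Set.mem_iInter]
    constructor
    · intro h u v hu hopen hux hG
      exact h u hu hux v hG hopen
    · intro h u hu hux v hG hopen
      exact h u v hu hopen hux hG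
  rw [heq]
  refine MeasurableSet.iInter fun u => MeasurableSet.iInter fun v => ?_
  by_cases hP : (u ≠ x → G.Adj u v →
      (v ∈ boxSet G o x A r ∧ (v ∈ lowSet G o x ∨ v = x)) ∨ autWeight G o v ≤ A)
  · have : {ω : BondConfig V | u ∈ boxCluster G o x x' A r ω → s(u, v) ∈ ω →
        (u ≠ x → G.Adj u v →
          (v ∈ boxSet G o x A r ∧ (v ∈ lowSet G o x ∨ v = x)) ∨ autWeight G o v ≤ A)} =
        Set.univ := Set.eq_univ_of_forall fun _ _ _ => hP
    rw [this]
    exact MeasurableSet.univ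
  · have : {ω : BondConfig V | u ∈ boxCluster G o x x' A r ω → s(u, v) ∈ ω →
        (u ≠ x → G.Adj u v →
          (v ∈ boxSet G o x A r ∧ (v ∈ lowSet G o x ∨ v = x)) ∨ autWeight G o v ≤ A)} =
        {ω | u ∈ boxCluster G o x x' A r ω}ᶜ ∪ {ω | s(u, v) ∈ ω}ᶜ := by
      ext ω
      simp only [Set.mem_setOf_eq, Set.mem_union, Set.mem_compl_iff]
      tauto
    rw [this]
    exact (measurableSet_mem_boxCluster x x' A r u).compl.union (measurable_set_mem _).setOf.compl

/-- **The good event is measurable** (given `x` lies in its box). [folklore] -/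
theorem measurableSet_boxGood {x x' : V} {A : ℝ≥0∞} {r : ℕ} (hxA : x ∈ boxSet G o x A r)
    (k : ℕ) : MeasurableSet (boxGood G o x x' A r k) :=
  (measurableSet_le_encard_inter ((ballSet_finite G x r).subset Set.inter_subset_right)
    (fun ω => boxCluster_subset_boxSet hxA ω) (measurableSet_mem_boxCluster x x' A r) k).inter
    (measurableSet_boxSealed x x' A r)

end Measurable

/-! ### Equivariance under automorphisms ("these events can be mapped into each other by some
automorphisms and our probability measure is invariant under automorphisms") -/

section Equivariance

variable {G : SimpleGraph V} [G.LocallyFinite] {o : V}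

/-- `γ v` is low for `γ x` iff `v` is low for `x`. [folklore] -/
theorem mem_lowSet_map_iff (hconn : G.Connected) (γ : G ≃g G) {x v : V} :
    γ v ∈ lowSet G o (γ x) ↔ v ∈ lowSet G o x := by
  show autWeight G o (γ v) ≤ minNbrWeight G o * autWeight G o (γ x) ↔
    autWeight G o v ≤ minNbrWeight G o * autWeight G o x
  rw [autWeight_map_eq_mul G hconn γ o v, autWeight_map_eq_mul G hconn γ o x, mul_left_comm]
  exact ENNReal.mul_le_mul_iff_right (autWeight_ne_zero G hconn o _) (autWeight_ne_top G hconn o _)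

omit [G.LocallyFinite] in
/-- `s(γ u, γ v) = s(γ x, γ x') ↔ s(u, v) = s(x, x')`. [folklore] -/
theorem sym2_map_eq_iff (γ : G ≃g G) {u v x x' : V} :
    s(γ u, γ v) = s(γ x, γ x') ↔ s(u, v) = s(x, x') := by
  simp only [Sym2.eq_iff, γ.injective.eq_iff]

/-- `G'(γ x)` with mate `γ x'` is the image of `G'(x)`. [cite: Timar2006, §4 (proof of Thm. 4.3: G'(x) is the image of G'(o))] -/
theorem lowerGraph_map_adj_iff (hconn : G.Connected) (γ : G ≃g G) {x x' u v : V} :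
    (lowerGraph G o (γ x) (γ x')).Adj (γ u) (γ v) ↔ (lowerGraph G o x x').Adj u v := by
  simp only [lowerGraph_adj, mem_lowSet_map_iff hconn γ, sym2_map_eq_iff γ,
    SimpleGraph.Iso.map_adj_iff]

/-- Boxes are transported, the threshold being rescaled: `γ v ∈ boxSet (γ x) (c A) ↔ v ∈ boxSet x A`
with `c = w(γ o)`. [folklore] -/
theorem mem_boxSet_map_iff (hconn : G.Connected) (γ : G ≃g G) {x v : V} {A : ℝ≥0∞} {r : ℕ} :
    γ v ∈ boxSet G o (γ x) (autWeight G o (γ o) * A) r ↔ v ∈ boxSet G o x A r := by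
  simp only [boxSet, Set.mem_inter_iff, Set.mem_setOf_eq, mem_ballSet_map_iff,
    autWeight_map_eq_mul G hconn γ o v]
  rw [(ENNReal.mul_right_strictMono (autWeight_ne_zero G hconn o _)
    (autWeight_ne_top G hconn o _)).lt_iff_lt]

/-- The box graphs are transported. [folklore] -/
theorem boxGraph_map_adj_iff (hconn : G.Connected) (γ : G ≃g G) {x x' u v : V} {A : ℝ≥0∞}
    {r : ℕ} :
    (boxStepGraph G o (γ x) (γ x') (autWeight G o (γ o) * A) r).Adj (γ u) (γ v) ↔
      (boxStepGraph G o x x' A r).Adj u v := by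
  simp only [boxStepGraph, withinGraph_adj, lowerGraph_map_adj_iff hconn γ, mem_boxSet_map_iff hconn γ]

/-- **The component of the transported box in the relabelled configuration is the image of the
component.** [cite: Timar2006, §4 (proof of Thm. 4.3: "these events can be mapped into each other by some automorphisms")] -/
theorem boxCluster_map (hconn : G.Connected) (γ : G ≃g G) (x x' : V) (A : ℝ≥0∞) (r : ℕ)
    (ω : BondConfig V) :
    boxCluster G o (γ x) (γ x') (autWeight G o (γ o) * A) r
        (BondConfig.relabel (sym2Equiv γ.toEquiv) ω) =
      (γ : V → V) '' boxCluster G o x x' A r ω :=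
  openClusterIn_relabel γ.toEquiv (fun _ _ => boxGraph_map_adj_iff hconn γ) ω x

/-- Windows are transported. [folklore] -/
theorem mem_wwindow_map_iff (hconn : G.Connected) (γ : G ≃g G) {v : V} {A : ℝ≥0∞} :
    γ v ∈ wwindow G o (autWeight G o (γ o) * A) ↔ v ∈ wwindow G o A := by
  have h0 := autWeight_ne_zero G hconn o (γ o)
  have hT := autWeight_ne_top G hconn o (γ o)
  simp only [wwindow, Set.mem_setOf_eq, autWeight_map_eq_mul G hconn γ o v]
  rw [(ENNReal.mul_right_strictMono h0 hT).lt_iff_lt, mul_assoc, ENNReal.mul_le_mul_iff_right h0 hT]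

/-- The weight comparison with the threshold is transported. [folklore] -/
theorem autWeight_map_le_iff (hconn : G.Connected) (γ : G ≃g G) {v : V} {A : ℝ≥0∞} :
    autWeight G o (γ v) ≤ autWeight G o (γ o) * A ↔ autWeight G o v ≤ A := by
  rw [autWeight_map_eq_mul G hconn γ o v]
  exact ENNReal.mul_le_mul_iff_right (autWeight_ne_zero G hconn o _) (autWeight_ne_top G hconn o _)

/-- Sealedness is transported. [folklore] -/
theorem boxSealed_map_iff (hconn : G.Connected) (γ : G ≃g G) {x x' : V} {A : ℝ≥0∞} {r : ℕ}
    {ω : BondConfig V} :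
    BoxSealed G o (γ x) (γ x') (autWeight G o (γ o) * A) r
        (BondConfig.relabel (sym2Equiv γ.toEquiv) ω) ↔
      BoxSealed G o x x' A r ω := by
  unfold BoxSealed
  rw [boxCluster_map hconn γ x x' A r ω]
  constructor
  · intro h u hu hux v hG hopen
    have h' := h (γ u) ⟨u, hu, rfl⟩ (γ.injective.ne hux) (γ v)
      ((SimpleGraph.Iso.map_adj_iff γ).2 hG) ((mk_mem_relabel_iff γ.toEquiv ω u v).2 hopen)
    rwa [mem_boxSet_map_iff hconn γ, mem_lowSet_map_iff hconn γ, γ.injective.eq_iff,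
      autWeight_map_le_iff hconn γ] at h'
  · rintro h _ ⟨u, hu, rfl⟩ hux v' hG' hopen'
    obtain ⟨v, rfl⟩ : ∃ v, γ v = v' := ⟨γ.symm v', γ.apply_symm_apply v'⟩
    have hG : G.Adj u v := (SimpleGraph.Iso.map_adj_iff γ).1 hG'
    have hopen : s(u, v) ∈ ω := (mk_mem_relabel_iff γ.toEquiv ω u v).1 hopen'
    have h' := h u hu (fun hu' => hux (congrArg γ hu')) v hG hopen
    rwa [mem_boxSet_map_iff hconn γ, mem_lowSet_map_iff hconn γ, γ.injective.eq_iff,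
      autWeight_map_le_iff hconn γ]

/-- **The good event is transported**: `γ·ω` is good for the box of `γ x` (mate `γ x'`,
threshold `w(γ o) A`) iff `ω` is good for the box of `x` (mate `x'`, threshold `A`).
[cite: Timar2006, §4 (proof of Thm. 4.3: "the probability of F(x) =: F is independent of x because these events can be mapped into each other by some automorphisms")] -/
theorem relabel_mem_boxGood_iff (hconn : G.Connected) (γ : G ≃g G) {x x' : V} {A : ℝ≥0∞}
    {r k : ℕ} {ω : BondConfig V} :
    BondConfig.relabel (sym2Equiv γ.toEquiv) ω ∈
        boxGood G o (γ x) (γ x') (autWeight G o (γ o) * A) r k ↔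
      ω ∈ boxGood G o x x' A r k := by
  simp only [boxGood, Set.mem_setOf_eq, boxSealed_map_iff hconn γ, boxCluster_map hconn γ]
  have himg : (γ : V → V) '' boxCluster G o x x' A r ω ∩ wwindow G o (autWeight G o (γ o) * A) =
      (γ : V → V) '' (boxCluster G o x x' A r ω ∩ wwindow G o A) := by
    ext v'
    constructor
    · rintro ⟨⟨v, hv, rfl⟩, hw⟩
      exact ⟨v, ⟨hv, (mem_wwindow_map_iff hconn γ).1 hw⟩, rfl⟩
    · rintro ⟨v, ⟨hv, hw⟩, rfl⟩
      exact ⟨⟨v, hv, rfl⟩, (mem_wwindow_map_iff hconn γ).2 hw⟩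
  rw [himg, γ.injective.encard_image]

/-- Preimage form of `relabel_mem_boxGood_iff`. [folklore] -/
theorem preimage_relabel_boxGood (hconn : G.Connected) (γ : G ≃g G) (x x' : V) (A : ℝ≥0∞)
    (r k : ℕ) :
    BondConfig.relabel (sym2Equiv γ.toEquiv) ⁻¹'
        boxGood G o (γ x) (γ x') (autWeight G o (γ o) * A) r k =
      boxGood G o x x' A r k := by
  ext ω
  rw [Set.mem_preimage]
  exact relabel_mem_boxGood_iff hconn γ

/-- **The probability of being good is the same for a box and its image under an automorphism**
(invariance of `P_p` under `Aut(G)`, `bondPercolation_map_relabel_iso`).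
[cite: Timar2006, §4 (proof of Thm. 4.3: "our probability measure is invariant under automorphisms")] -/
theorem measure_boxGood_map (hconn : G.Connected) (γ : G ≃g G) (p : unitInterval) (x x' : V)
    (A : ℝ≥0∞) (r k : ℕ) :
    bondPercolation G p (boxGood G o (γ x) (γ x') (autWeight G o (γ o) * A) r k) =
      bondPercolation G p (boxGood G o x x' A r k) := by
  calc bondPercolation G p (boxGood G o (γ x) (γ x') (autWeight G o (γ o) * A) r k)
      = ((bondPercolation G p).map (BondConfig.relabel (sym2Equiv γ.toEquiv)))
          (boxGood G o (γ x) (γ x') (autWeight G o (γ o) * A) r k) := by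
        rw [bondPercolation_map_relabel_iso]
    _ = bondPercolation G p (BondConfig.relabel (sym2Equiv γ.toEquiv) ⁻¹'
          boxGood G o (γ x) (γ x') (autWeight G o (γ o) * A) r k) :=
        MeasurableEquiv.map_apply _ _
    _ = bondPercolation G p (boxGood G o x x' A r k) := by
        rw [preimage_relabel_boxGood hconn γ]

end Equivariance

/-! ### Open clusters: two folklore facts -/

section Cluster

/-- A vertex of `C(x)` has the same open cluster. [folklore] -/
theorem openCluster_eq_openCluster_of_mem {ω : BondConfig V} {x y : V} (hy : y ∈ openCluster ω x) :
    openCluster ω y = openCluster ω x := by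
  ext z
  exact ⟨fun hz => SimpleGraph.Reachable.trans hy hz, fun hz => SimpleGraph.Reachable.trans hy.symm hz⟩

/-- An open edge from a vertex of `C(x)` leads into `C(x)`. [folklore] -/
theorem mem_openCluster_of_adj {ω : BondConfig V} {x u v : V} (hu : u ∈ openCluster ω x)
    (huv : s(u, v) ∈ ω) (hne : u ≠ v) : v ∈ openCluster ω x :=
  SimpleGraph.Reachable.trans hu (SimpleGraph.Adj.reachable ((openGraph_adj ω u v).2 ⟨huv, hne⟩))

end Cluster

/-! ### Total weight: monotonicity (heaviness under automorphisms is `isHeavy_image_iff` of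
`TimarHeavyClustersErgodic.lean`) -/

section Weight

/-- The total weight of `insert x C` is at most `w(x) + W(C)`. [folklore] -/
theorem setWeight_insert_le (G : SimpleGraph V) (o x : V) (C : Set V) :
    setWeight G o (insert x C) ≤ autWeight G o x + setWeight G o C := by
  have hx : setWeight G o ({x} : Set V) = autWeight G o x := by
    rw [setWeight, tsum_eq_single x]
    · rw [Set.indicator_of_mem (Set.mem_singleton x)]
    · intro v hv
      exact Set.indicator_of_notMem (fun h => hv (Set.mem_singleton_iff.1 h)) _
  rw [← hx, Set.insert_eq, setWeight, setWeight, setWeight, ← ENNReal.tsum_add]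
  refine ENNReal.tsum_le_tsum fun v => ?_
  by_cases h1 : v ∈ ({x} : Set V)
  · rw [Set.indicator_of_mem (Set.mem_union_left C h1), Set.indicator_of_mem h1]
    exact le_self_add
  · rw [Set.indicator_of_notMem h1, zero_add]
    by_cases h2 : v ∈ C
    · rw [Set.indicator_of_mem (Set.mem_union_right _ h2), Set.indicator_of_mem h2]
    · rw [Set.indicator_of_notMem h2, Set.indicator_of_notMem]
      rintro (h | h)
      · exact h1 h
      · exact h2 h

end Weight

/-! ### Nice clusters and the event `F(x)` -/

section Nice

variable (G : SimpleGraph V) [G.LocallyFinite] (o : V)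

/-- **Nice** (`C(x) = C(x)|_{G'(x)}`), in closed-edge form: the only open edge of `G` at `x` is
the long edge `{x, x'}`, and a vertex of `C(x)` other than `x` has open edges only to vertices of
weight `≤ Δ w(x)` or to `x`. [cite: Timar2006, §4 (proof of Thm. 4.3: "C(x) is nice if C(x) = C(x)|_{G'(x)}")] -/
def IsNice (x x' : V) (ω : BondConfig V) : Prop :=
  (∀ y : V, G.Adj x y → s(x, y) ∈ ω → y = x') ∧
    ∀ u ∈ openCluster ω x, u ≠ x → ∀ v : V, G.Adj u v → s(u, v) ∈ ω → v ∈ lowSet G o x ∨ v = x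

/-- **The event `F(x)`**: `C(x)` is infinite, light and nice.
[cite: Timar2006, §4 (proof of Thm. 4.3: "Let F(x) be the event that C(x) is infinite, light and nice")] -/
def niceEvent (x x' : V) : Set (BondConfig V) :=
  {ω | (openCluster ω x).Infinite ∧ ¬ IsHeavy G o (openCluster ω x) ∧ IsNice G o x x' ω}

variable {G o}

/-- Along an open walk from a vertex of `C(x)` which is `x` or low, in a nice configuration on
`E(G)`, every vertex is `x` or low (for `x'` low). [folklore] -/
theorem eq_or_mem_lowSet_of_nice_walk (hconn : G.Connected) (htr : IsGraphTransitive G)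
    (hU : ¬ IsGraphUnimodular G) {x x' : V} (hx' : x' ∈ lowSet G o x) {ω : BondConfig V}
    (hω : ω ⊆ G.edgeSet) (hnice : IsNice G o x x' ω) :
    ∀ {c d : V} (_ : (openGraph ω).Walk c d), c ∈ openCluster ω x → (c = x ∨ c ∈ lowSet G o x) →
      (d = x ∨ d ∈ lowSet G o x)
  | _, _, .nil, _, h => h
  | c, d, .cons (v := e) hadj q, hc, h => by
    have hopen : s(c, e) ∈ ω := ((openGraph_adj ω c e).1 hadj).1
    have hne : c ≠ e := ((openGraph_adj ω c e).1 hadj).2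
    have hG : G.Adj c e := (SimpleGraph.mem_edgeSet G).1 (hω hopen)
    have he : e ∈ openCluster ω x := mem_openCluster_of_adj hc hopen hne
    refine eq_or_mem_lowSet_of_nice_walk hconn htr hU hx' hω hnice q he ?_
    rcases h with rfl | hclow
    · exact Or.inr ((hnice.1 e hG hopen) ▸ hx')
    · have hcx : c ≠ x := fun hcx => not_mem_lowSet_self hconn htr hU x (hcx ▸ hclow)
      rcases hnice.2 c hc hcx e hG hopen with helow | rfl
      · exact Or.inr helow
      · exact Or.inl rfl

/-- **The vertices of a nice cluster other than `x` are low.** [cite: Timar2006, §4 (proof of Thm. 4.3: nice clusters live in G'(x))] -/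
theorem mem_lowSet_of_nice (hconn : G.Connected) (htr : IsGraphTransitive G)
    (hU : ¬ IsGraphUnimodular G) {x x' : V} (hx' : x' ∈ lowSet G o x) {ω : BondConfig V}
    (hω : ω ⊆ G.edgeSet) (hnice : IsNice G o x x' ω) {u : V} (hu : u ∈ openCluster ω x)
    (hux : u ≠ x) : u ∈ lowSet G o x := by
  obtain ⟨p⟩ := hu
  exact (eq_or_mem_lowSet_of_nice_walk hconn htr hU hx' hω hnice p (mem_openCluster_self ω x)
    (Or.inl rfl)).resolve_left hux

/-! ### Good boxes from nice clusters -/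

/-- **On `F`-type configurations the box of `x` is good**: if `ω` (on `E(G)`) is nice at `x` with
a low mate `x'`, `A < w(x)`, the vertices of `C(x)` of weight `> A` all lie in `B(x, r)`, and the
cluster of `x` inside `{w > A}` has at least `k` vertices in the window `(A, A Δ⁻¹]`, then
`ω ∈ boxGood G o x x' A r k`: the constrained cluster lies in the component of the box (its steps
are steps of `G'(x)` by niceness, inside the ball by the containment), and the component is sealed
(an open edge from `C(x) ∖ {x}` leads to a low vertex of `C(x)`, inside the box if of weight `> A`,
or to `x`). [cite: Timar2006, §4 (proof of Thm. 4.3: choice of i and r making B_o(i; r) good)] -/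
theorem boxGood_of_nice (hconn : G.Connected) (htr : IsGraphTransitive G)
    (hU : ¬ IsGraphUnimodular G) {x x' : V} (hx' : x' ∈ lowSet G o x) {A : ℝ≥0∞} {r k : ℕ}
    (hxA : A < autWeight G o x) {ω : BondConfig V} (hω : ω ⊆ G.edgeSet) (hnice : IsNice G o x x' ω)
    (hcont : openCluster ω x ∩ {v | A < autWeight G o v} ⊆ ballSet G x r)
    (hmany : (k : ℕ∞) ≤ (openClusterIn (withinGraph G {v | A < autWeight G o v}) ω x ∩
      wwindow G o A).encard) :
    ω ∈ boxGood G o x x' A r k := by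
  have hxbox : x ∈ boxSet G o x A r := mem_boxSet_self hxA r
  -- one step of the constrained cluster is a step of the box graph
  have step : ∀ {c d : V}, c ∈ boxCluster G o x x' A r ω →
      (openGraph ω ⊓ withinGraph G {v | A < autWeight G o v}).Adj c d →
      d ∈ boxCluster G o x x' A r ω := by
    intro c d hc hadj
    have hopen : s(c, d) ∈ ω := ((openGraph_adj ω c d).1 hadj.1).1
    have hne : c ≠ d := ((openGraph_adj ω c d).1 hadj.1).2
    have hG : G.Adj c d := hadj.2.1
    have hdA : A < autWeight G o d := hadj.2.2.2
    have hcC : c ∈ openCluster ω x := boxCluster_subset_openCluster x x' A r ω hc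
    have hdC : d ∈ openCluster ω x := mem_openCluster_of_adj hcC hopen hne
    have hdbox : d ∈ boxSet G o x A r := ⟨hdA, hcont ⟨hdC, hdA⟩⟩
    have hlow : (c ∈ lowSet G o x ∧ d ∈ lowSet G o x) ∨ s(c, d) = s(x, x') := by
      by_cases hcx : c = x
      · subst hcx
        exact Or.inr (by rw [hnice.1 d hG hopen])
      · have hclow : c ∈ lowSet G o x := mem_lowSet_of_nice hconn htr hU hx' hω hnice hcC hcx
        rcases hnice.2 c hcC hcx d hG hopen with hdlow | rfl
        · exact Or.inl ⟨hclow, hdlow⟩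
        · -- `d = x`: the open edge `{c, x}` at `x` forces `c = x'`
          have hcx' : c = x' := hnice.1 c hG.symm (by rw [Sym2.eq_swap]; exact hopen)
          exact Or.inr (by rw [hcx', Sym2.eq_swap])
    exact mem_openClusterIn_of_adj hc ⟨⟨hG, hlow⟩, boxCluster_subset_boxSet hxbox ω hc, hdbox⟩ hopen
  have key : ∀ {c v : V} (_ : (openGraph ω ⊓ withinGraph G {v | A < autWeight G o v}).Walk c v),
      c ∈ boxCluster G o x x' A r ω → v ∈ boxCluster G o x x' A r ω := by
    intro c v W
    induction W with
    | nil => exact id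
    | cons hadj _ ih => exact fun hc => ih (step hc hadj)
  have hsub : openClusterIn (withinGraph G {v | A < autWeight G o v}) ω x ⊆
      boxCluster G o x x' A r ω := by
    intro v hv
    rw [mem_openClusterIn_iff] at hv
    obtain ⟨W⟩ := hv
    exact key W (self_mem_openClusterIn _ ω x)
  refine ⟨hmany.trans (Set.encard_le_encard (Set.inter_subset_inter_left _ hsub)), ?_⟩
  -- sealed
  intro u hu hux v hG hopen
  have huC : u ∈ openCluster ω x := boxCluster_subset_openCluster x x' A r ω hu
  by_cases hvA : autWeight G o v ≤ A
  · exact Or.inr hvA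
  have hvA' : A < autWeight G o v := not_le.1 hvA
  have hvC : v ∈ openCluster ω x := mem_openCluster_of_adj huC hopen hG.ne
  exact Or.inl ⟨⟨hvA', hcont ⟨hvC, hvA'⟩⟩, hnice.2 u huC hux v hG hopen⟩

/-! ### Measurability -/

section Measurable

variable [Countable V]

omit [G.LocallyFinite] in
/-- `{y ∈ C(x)}` is measurable. [folklore] -/
theorem measurableSet_mem_openCluster (x y : V) :
    MeasurableSet {ω : BondConfig V | y ∈ openCluster ω x} :=
  measurableSet_openConn_holds x y

omit [Countable V] in
/-- An event of the shape `{ω | a ∈ S ω → e ∈ ω → P}` with `{a ∈ S ·}` measurable and `P` not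
depending on `ω` is measurable. [folklore] -/
theorem measurableSet_imp_imp {S : BondConfig V → Set V} {a : V} (hS : MeasurableSet {ω | a ∈ S ω})
    (e : Sym2 V) (P : Prop) : MeasurableSet {ω : BondConfig V | a ∈ S ω → e ∈ ω → P} := by
  by_cases hP : P
  · have : {ω : BondConfig V | a ∈ S ω → e ∈ ω → P} = Set.univ :=
      Set.eq_univ_of_forall fun _ _ _ => hP
    rw [this]; exact MeasurableSet.univ
  · have : {ω : BondConfig V | a ∈ S ω → e ∈ ω → P} = {ω | a ∈ S ω}ᶜ ∪ {ω | e ∈ ω}ᶜ := by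
      ext ω; simp only [Set.mem_setOf_eq, Set.mem_union, Set.mem_compl_iff]; tauto
    rw [this]; exact hS.compl.union (measurable_set_mem _).setOf.compl

/-- The niceness event is measurable. [folklore] -/
theorem measurableSet_isNice (x x' : V) : MeasurableSet {ω : BondConfig V | IsNice G o x x' ω} := by
  have h1 : MeasurableSet {ω : BondConfig V | ∀ y : V, G.Adj x y → s(x, y) ∈ ω → y = x'} := by
    have : {ω : BondConfig V | ∀ y : V, G.Adj x y → s(x, y) ∈ ω → y = x'} =
        ⋂ y : V, {ω | x ∈ openCluster ω x → s(x, y) ∈ ω → (G.Adj x y → y = x')} := by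
      ext ω; simp only [Set.mem_setOf_eq, Set.mem_iInter]
      exact ⟨fun h y _ hy hG => h y hG hy, fun h y hG hy => h y (mem_openCluster_self ω x) hy hG⟩
    rw [this]
    exact MeasurableSet.iInter fun y =>
      measurableSet_imp_imp (measurableSet_mem_openCluster x x) _ _
  have h2 : MeasurableSet {ω : BondConfig V | ∀ u ∈ openCluster ω x, u ≠ x → ∀ v : V, G.Adj u v →
      s(u, v) ∈ ω → v ∈ lowSet G o x ∨ v = x} := by
    have : {ω : BondConfig V | ∀ u ∈ openCluster ω x, u ≠ x → ∀ v : V, G.Adj u v →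
        s(u, v) ∈ ω → v ∈ lowSet G o x ∨ v = x} =
        ⋂ u : V, ⋂ v : V, {ω | u ∈ openCluster ω x → s(u, v) ∈ ω →
          (u ≠ x → G.Adj u v → v ∈ lowSet G o x ∨ v = x)} := by
      ext ω; simp only [Set.mem_setOf_eq, Set.mem_iInter]
      exact ⟨fun h u v hu hopen hux hG => h u hu hux v hG hopen,
        fun h u hu hux v hG hopen => h u v hu hopen hux hG⟩
    rw [this]
    exact MeasurableSet.iInter fun u => MeasurableSet.iInter fun v =>
      measurableSet_imp_imp (measurableSet_mem_openCluster x u) _ _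
  exact h1.inter h2

/-- **`F(x)` is measurable.** [folklore] -/
theorem measurableSet_niceEvent (x x' : V) : MeasurableSet (niceEvent G o x x') := by
  have : niceEvent G o x x' = percolatesAt x ∩
      ({ω | IsHeavy G o (openCluster ω x)}ᶜ ∩ {ω | IsNice G o x x' ω}) := by
    ext ω
    simp only [niceEvent, percolatesAt, Set.mem_setOf_eq, Set.mem_inter_iff, Set.mem_compl_iff]
  rw [this]
  exact (measurableSet_percolatesAt_holds x).inter
    ((measurableSet_isHeavy_openCluster G o x).compl.inter
      (measurableSet_isNice (G := G) (o := o) x x'))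

end Measurable

/-! ### `q > 0`: uppermost vertices, transport to `o'`, and the surgery at `o` -/

variable (G o) in
/-- The event "`C(t)` is infinite and light and `t` is an uppermost vertex of it".
[cite: Timar2006, §4 (proof of Thm. 4.3: "the event that o' is an uppermost vertex of a light cluster")] -/
def uppermostEvent (t : V) : Set (BondConfig V) :=
  {ω | (openCluster ω t).Infinite ∧ ¬ IsHeavy G o (openCluster ω t) ∧
    ∀ u ∈ openCluster ω t, autWeight G o u ≤ autWeight G o t}

/-- **An infinite light cluster has an uppermost vertex**: if `C(x)` is infinite and light, some
`t ∈ C(x)` has `C(t) = C(x)` infinite, light, with all weights on it `≤ w(t)`.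
[cite: Timar2006, §2 ("Infinite Bernoulli(p) clusters of a grandmother graph have finitely many uppermost vertices") and §4 (proof of Thm. 4.3)] -/
theorem exists_uppermost (hconn : G.Connected) {x : V} {ω : BondConfig V}
    (hinf : (openCluster ω x).Infinite) (hlight : ¬ IsHeavy G o (openCluster ω x)) :
    ∃ t : V, ω ∈ uppermostEvent G o t := by
  -- the finite nonempty set of vertices of `C(x)` of weight `≥ w(x)` has a heaviest element
  have hfin := finite_inter_of_not_isHeavy hlight (autWeight_ne_zero G hconn o x)
  have hne : (openCluster ω x ∩ {v | autWeight G o x ≤ autWeight G o v}).Nonempty :=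
    ⟨x, mem_openCluster_self ω x, (le_rfl : autWeight G o x ≤ autWeight G o x)⟩
  obtain ⟨t, ⟨htC, htx⟩, hmax⟩ := Set.Finite.exists_maximalFor (autWeight G o) _ hfin hne
  refine ⟨t, ?_, ?_, ?_⟩
  · rw [openCluster_eq_openCluster_of_mem htC]; exact hinf
  · rw [openCluster_eq_openCluster_of_mem htC]; exact hlight
  · intro u hu
    rw [openCluster_eq_openCluster_of_mem htC] at hu
    by_cases hux : autWeight G o x ≤ autWeight G o u
    · rcases le_total (autWeight G o t) (autWeight G o u) with h | h
      · exact hmax ⟨hu, hux⟩ h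
      · exact h
    · exact ((not_le.1 hux).le).trans htx

/-- The uppermost event is carried by automorphisms. [folklore] -/
theorem relabel_mem_uppermostEvent_iff (hconn : G.Connected) (γ : G ≃g G) {t : V}
    {ω : BondConfig V} :
    BondConfig.relabel (sym2Equiv γ.toEquiv) ω ∈ uppermostEvent G o (γ t) ↔
      ω ∈ uppermostEvent G o t := by
  have hC : openCluster (BondConfig.relabel (sym2Equiv γ.toEquiv) ω) (γ t) =
      (γ : V → V) '' openCluster ω t := (image_openCluster_relabel γ.toEquiv ω t).symm
  have h0 := autWeight_ne_zero G hconn o (γ o)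
  have hT := autWeight_ne_top G hconn o (γ o)
  simp only [uppermostEvent, Set.mem_setOf_eq, hC, Set.infinite_image_iff γ.injective.injOn,
    isHeavy_image_iff G hconn γ o]
  refine and_congr_right fun _ => and_congr_right fun _ => ?_
  constructor
  · intro h u hu
    have := h (γ u) ⟨u, hu, rfl⟩
    rwa [autWeight_map_eq_mul G hconn γ o u, autWeight_map_eq_mul G hconn γ o t, ENNReal.mul_le_mul_iff_right h0 hT]
      at this
  · rintro h _ ⟨u, hu, rfl⟩
    rw [autWeight_map_eq_mul G hconn γ o u, autWeight_map_eq_mul G hconn γ o t, ENNReal.mul_le_mul_iff_right h0 hT]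
    exact h u hu

/-- Hence the uppermost events at the vertices of one orbit have one probability. [cite: Timar2006, §4 (proof of Thm. 4.3: invariance under automorphisms)] -/
theorem measure_uppermostEvent_map (hconn : G.Connected) (γ : G ≃g G) (p : unitInterval) (t : V) :
    bondPercolation G p (uppermostEvent G o (γ t)) = bondPercolation G p (uppermostEvent G o t) := by
  have hpre : BondConfig.relabel (sym2Equiv γ.toEquiv) ⁻¹' uppermostEvent G o (γ t) =
      uppermostEvent G o t := by
    ext ω; rw [Set.mem_preimage]; exact relabel_mem_uppermostEvent_iff hconn γ
  calc bondPercolation G p (uppermostEvent G o (γ t))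
      = ((bondPercolation G p).map (BondConfig.relabel (sym2Equiv γ.toEquiv)))
          (uppermostEvent G o (γ t)) := by rw [bondPercolation_map_relabel_iso]
    _ = bondPercolation G p
          (BondConfig.relabel (sym2Equiv γ.toEquiv) ⁻¹' uppermostEvent G o (γ t)) :=
        MeasurableEquiv.map_apply _ _
    _ = bondPercolation G p (uppermostEvent G o t) := by rw [hpre]

omit [G.LocallyFinite] in
/-- Removing edges all containing a vertex `z ∉ C(t)` does not change `C(t)`. [folklore] -/
theorem openCluster_sdiff_eq_of_notMem {ω : BondConfig V} {t z : V} (hz : z ∉ openCluster ω t)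
    (E : Set (Sym2 V)) (hE : ∀ e ∈ E, z ∈ e) : openCluster (ω \ E) t = openCluster ω t := by
  refine Set.Subset.antisymm (openCluster_mono (fun _ h => h.1) t) ?_
  -- an open walk from `t` avoids `z`, hence uses no edge of `E`
  have step : ∀ {c d : V}, c ∈ openCluster ω t → (openGraph ω).Adj c d →
      (openGraph (ω \ E)).Adj c d ∧ d ∈ openCluster ω t := by
    intro c d hc hadj
    have hopen : s(c, d) ∈ ω := ((openGraph_adj ω c d).1 hadj).1
    have hne : c ≠ d := ((openGraph_adj ω c d).1 hadj).2
    have hd : d ∈ openCluster ω t := mem_openCluster_of_adj hc hopen hne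
    have hcz : c ≠ z := fun h => hz (h ▸ hc)
    have hdz : d ≠ z := fun h => hz (h ▸ hd)
    have hnot : s(c, d) ∉ E := fun h => by
      rcases Sym2.mem_iff.1 (hE _ h) with h | h
      · exact hcz h.symm
      · exact hdz h.symm
    exact ⟨(openGraph_adj _ c d).2 ⟨⟨hopen, hnot⟩, hne⟩, hd⟩
  have key : ∀ {c d : V} (_ : (openGraph ω).Walk c d), c ∈ openCluster ω t →
      (openGraph (ω \ E)).Reachable c d := by
    intro c d W
    induction W with
    | nil => exact fun _ => SimpleGraph.Reachable.refl _
    | cons hadj _ ih =>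
      intro hc
      obtain ⟨hadj', hd⟩ := step hc hadj
      exact hadj'.reachable.trans (ih hd)
  intro u hu
  obtain ⟨W⟩ := hu
  exact key W (mem_openCluster_self ω t)

omit [G.LocallyFinite] in
/-- After the surgery "delete the edges at `o` (a set `E` of edges containing every open edge at
`o`), then insert `{o, o'}`", every vertex of the new `C(o)` is `o` or a vertex of `C(o')`
computed in `ω ∖ E`. [folklore] -/
theorem eq_or_mem_openCluster_of_surgery_walk {ω : BondConfig V} {o' : V} (E : Set (Sym2 V))
    (hE : ∀ y : V, s(o, y) ∈ ω → s(o, y) ∈ E) :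
    ∀ {c d : V} (_ : (openGraph ((ω \ E) ∪ {s(o, o')})).Walk c d),
      (c = o ∨ c ∈ openCluster (ω \ E) o') → (d = o ∨ d ∈ openCluster (ω \ E) o')
  | _, _, .nil, h => h
  | c, d, .cons (v := e) hadj q, h => by
    refine eq_or_mem_openCluster_of_surgery_walk E hE q ?_
    have hopen : s(c, e) ∈ (ω \ E) ∪ {s(o, o')} := ((openGraph_adj _ c e).1 hadj).1
    have hne : c ≠ e := ((openGraph_adj _ c e).1 hadj).2
    rcases hopen with hη | hoo'
    · -- an edge of `ω ∖ E` is not an edge at `o`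
      rcases h with rfl | hc
      · exact absurd (hE e hη.1) hη.2
      · exact Or.inr (mem_openCluster_of_adj hc hη hne)
    · rw [Set.mem_singleton_iff, Sym2.eq_iff] at hoo'
      rcases hoo' with ⟨-, rfl⟩ | ⟨-, rfl⟩
      · exact Or.inr (mem_openCluster_self _ _)
      · exact Or.inl rfl

/-- **The surgery produces `F(o)`** ("insert the edge between `o` and `o'` and delete all other
edges incident to `o`. In the resulting configurations …, `C(o)` is nice"): for `ω` on `E(G)` in
the uppermost event at `o'` (a neighbour of `o` of weight `Δ`), the configuration
`(ω ∖ E_o) ∪ {{o, o'}}` (`E_o` the edges of `G` at `o`) lies in `niceEvent G o o o'`.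
[cite: Timar2006, §4 (proof of Thm. 4.3: q > 0 by insertion and deletion tolerance)] -/
theorem openEdges_closeEdges_mem_niceEvent (hconn : G.Connected) (htr : IsGraphTransitive G)
    (hU : ¬ IsGraphUnimodular G) {o' : V} (hoo' : G.Adj o o')
    (ho' : autWeight G o o' = minNbrWeight G o) (F₁ : Finset (Sym2 V))
    (hF₁ : ∀ e : Sym2 V, e ∈ F₁ ↔ e ∈ G.edgeSet ∧ o ∈ e) {ω : BondConfig V} (hω : ω ⊆ G.edgeSet)
    (hup : ω ∈ uppermostEvent G o o') :
    openEdges (↑({s(o, o')} : Finset (Sym2 V))) (closeEdges ↑F₁ ω) ∈ niceEvent G o o o' := by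
  obtain ⟨hinf, hlight, htop⟩ := hup
  set E : Set (Sym2 V) := ↑F₁ with hEdef
  have hE : ∀ y : V, s(o, y) ∈ ω → s(o, y) ∈ E := by
    intro y hy
    rw [hEdef, Finset.mem_coe, hF₁]
    exact ⟨hω hy, Sym2.mem_mk_left o y⟩
  have hE' : ∀ e ∈ E, o ∈ e := by
    intro e he
    rw [hEdef, Finset.mem_coe, hF₁] at he
    exact he.2
  -- `o ∉ C(o')`: all weights on `C(o')` are `≤ Δ < 1 = w(o)`
  have hΔ1 := minNbrWeight_lt_one hconn htr hU o
  have hoC : o ∉ openCluster ω o' := by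
    intro h
    have := htop o h
    rw [autWeight_self G hconn o, ho'] at this
    exact absurd this (not_le.2 hΔ1)
  have hCeq : openCluster (ω \ E) o' = openCluster ω o' := openCluster_sdiff_eq_of_notMem hoC E hE'
  -- the new configuration and its cluster at `o`
  have hζ : openEdges (↑({s(o, o')} : Finset (Sym2 V))) (closeEdges E ω) = (ω \ E) ∪ {s(o, o')} := by
    rw [Finset.coe_singleton]; rfl
  rw [hζ]
  have hsub : openCluster ((ω \ E) ∪ {s(o, o')}) o ⊆ insert o (openCluster ω o') := by
    intro u hu
    obtain ⟨W⟩ := hu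
    have := eq_or_mem_openCluster_of_surgery_walk E hE W (Or.inl rfl)
    rw [hCeq] at this
    rcases this with rfl | h
    · exact Set.mem_insert _ _
    · exact Set.mem_insert_of_mem _ h
  have ho'ζ : o' ∈ openCluster ((ω \ E) ∪ {s(o, o')}) o :=
    SimpleGraph.Adj.reachable ((openGraph_adj _ o o').2 ⟨Or.inr rfl, hoo'.ne⟩)
  have hsup : openCluster ω o' ⊆ openCluster ((ω \ E) ∪ {s(o, o')}) o := by
    rw [← hCeq, ← openCluster_eq_openCluster_of_mem ho'ζ]
    exact openCluster_mono Set.subset_union_left o'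
  refine ⟨fun hfin => hinf (hfin.subset hsup), ?_, ?_, ?_⟩
  · -- light: `W(C_ζ(o)) ≤ w(o) + W(C(o')) < ∞`
    intro hheavy
    rw [IsHeavy] at hheavy
    have hle := (setWeight_mono G o hsub).trans (setWeight_insert_le G o o (openCluster ω o'))
    rw [hheavy, top_le_iff, ENNReal.add_eq_top] at hle
    rcases hle with h | h
    · exact autWeight_ne_top G hconn o o h
    · exact hlight h
  · -- the only open edge at `o` is `{o, o'}`
    intro y hG hy
    rcases hy with hη | hoo
    · exact absurd (hE y hη.1) hη.2
    · rw [Set.mem_singleton_iff, Sym2.eq_iff] at hoo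
      rcases hoo with ⟨-, h⟩ | ⟨h1, h2⟩
      · exact h
      · exact h2.trans h1
  · -- vertices of `C_ζ(o) ∖ {o}` have open edges only to low vertices or to `o`
    intro u hu huo v hG hopen
    have huC : u ∈ openCluster ω o' := by
      rcases hsub hu with h | h
      · exact absurd h huo
      · exact h
    rcases hopen with hη | hoo
    · have hv : v ∈ openCluster ω o' := mem_openCluster_of_adj huC hη.1 hG.ne
      left
      show autWeight G o v ≤ minNbrWeight G o * autWeight G o o
      rw [autWeight_self G hconn o, mul_one, ← ho']
      exact htop v hv
    · rw [Set.mem_singleton_iff, Sym2.eq_iff] at hoo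
      rcases hoo with ⟨h, -⟩ | ⟨-, h⟩
      · exact absurd h huo
      · exact Or.inr h

/-- **`q > 0`** ("By insertion and deletion tolerance and the assumption that there are light
clusters, we have `q := P[F] > 0`"): on a connected, locally finite, transitive nonunimodular
graph, under Bernoulli(`p`) bond percolation with `0 < p < 1`, if with positive probability some
open cluster is infinite and light, then `P[F(o)] > 0` for the mate `o'` (a neighbour of `o` of
weight `Δ`). [cite: Timar2006, §4 (proof of Thm. 4.3: q := P[F] > 0)] -/
theorem niceEvent_pos_of_lightCluster [Countable V] (hconn : G.Connected)
    (htr : IsGraphTransitive G) (hU : ¬ IsGraphUnimodular G) {o' : V} (hoo' : G.Adj o o')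
    (ho' : autWeight G o o' = minNbrWeight G o) {p : unitInterval} (hp0 : 0 < (p : ℝ))
    (hp1 : (p : ℝ) < 1)
    (hpos : bondPercolation G p
      {ω | ∃ x : V, (openCluster ω x).Infinite ∧ ¬ IsHeavy G o (openCluster ω x)} ≠ 0) :
    0 < bondPercolation G p (niceEvent G o o o') := by
  set μ := bondPercolation G p with hμ
  -- some uppermost event has positive probability
  have hsub : {ω : BondConfig V | ∃ x : V, (openCluster ω x).Infinite ∧
      ¬ IsHeavy G o (openCluster ω x)} ⊆ ⋃ t : V, uppermostEvent G o t := by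
    rintro ω ⟨x, hinf, hlight⟩
    obtain ⟨t, ht⟩ := exists_uppermost hconn hinf hlight
    exact Set.mem_iUnion.2 ⟨t, ht⟩
  have hU' : μ (⋃ t : V, uppermostEvent G o t) ≠ 0 := fun h => hpos (measure_mono_null hsub h)
  obtain ⟨t, ht⟩ : ∃ t : V, μ (uppermostEvent G o t) ≠ 0 := by
    by_contra h
    push Not at h
    exact hU' ((measure_iUnion_null_iff).2 h)
  -- carry it to `o'`
  obtain ⟨γ, hγ⟩ := htr t o'
  have ho'pos : μ (uppermostEvent G o o') ≠ 0 := by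
    rw [← hγ, hμ, measure_uppermostEvent_map hconn γ p t]; exact ht
  -- surgery: delete the edges at `o`, insert `{o, o'}`
  have hωE : ∀ᵐ ω ∂μ, ω ⊆ G.edgeSet := ProbabilityTheory.setBernoulli_ae_subset
  set A : Set (BondConfig V) := uppermostEvent G o o' ∩ {ω | ω ⊆ G.edgeSet} with hA
  have hAeq : μ A = μ (uppermostEvent G o o') := by
    refine measure_congr ?_
    filter_upwards [hωE] with ω hω
    exact propext ⟨fun h => h.1, fun h => ⟨h, hω⟩⟩
  have hApos : 0 < μ.real A := by
    rw [measureReal_def, ENNReal.toReal_pos_iff, hAeq]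
    exact ⟨pos_iff_ne_zero.2 ho'pos, measure_lt_top μ _⟩
  classical
  set F₁ : Finset (Sym2 V) := G.incidenceFinset o
  have hF₁ : ∀ e : Sym2 V, e ∈ F₁ ↔ e ∈ G.edgeSet ∧ o ∈ e := fun e =>
    SimpleGraph.mem_incidenceFinset (G := G) (v := o) (e := e)
  set F₂ : Finset (Sym2 V) := {s(o, o')}
  set E : Set (BondConfig V) := openEdges ↑F₂ ⁻¹' niceEvent G o o o' with hEdef
  have hEm : MeasurableSet E := measurable_openEdges _ (measurableSet_niceEvent o o')
  have hE : 0 < μ.real E := by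
    refine bondPercolation_real_pos_of_closeEdges G hp1 F₁ hEm hApos fun ω hω => ?_
    exact openEdges_closeEdges_mem_niceEvent hconn htr hU hoo' ho' F₁ hF₁ hω.2 hω.1
  have hF₂ : (↑F₂ : Set (Sym2 V)) ⊆ G.edgeSet := by
    intro e he
    rw [Finset.coe_singleton, Set.mem_singleton_iff] at he
    rw [he]; exact hoo'
  have hnice := bondPercolation_real_pos_of_openEdges G hp0 F₂ hF₂ (measurableSet_niceEvent o o')
    hE fun ω hω => hω
  rw [measureReal_def, ENNReal.toReal_pos_iff] at hnice
  exact hnice.1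

/-! ### The choice of `r`: a light cluster meets `{w ≥ B}` inside a large ball -/

variable (G o) in
/-- The event "`C(x) ∩ {w ≥ B} ⊆ B(x, r)`". [cite: Timar2006, §4 (proof of Thm. 4.3: "the probability that it intersects a large sphere around o can be made arbitrarily small")] -/
def containedEvent (x : V) (B : ℝ≥0∞) (r : ℕ) : Set (BondConfig V) :=
  {ω | openCluster ω x ∩ {v | B ≤ autWeight G o v} ⊆ ballSet G x r}

/-- The containment event is measurable. [folklore] -/
theorem measurableSet_containedEvent [Countable V] (x : V) (B : ℝ≥0∞) (r : ℕ) :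
    MeasurableSet (containedEvent G o x B r) := by
  have : containedEvent G o x B r =
      ⋂ v ∈ {v : V | B ≤ autWeight G o v ∧ v ∉ ballSet G x r}, {ω | v ∈ openCluster ω x}ᶜ := by
    ext ω
    simp only [containedEvent, Set.subset_def, Set.mem_inter_iff, Set.mem_setOf_eq, Set.mem_iInter,
      Set.mem_compl_iff]
    constructor
    · rintro h v ⟨hvB, hvball⟩ hvC
      exact hvball (h v ⟨hvC, hvB⟩)
    · rintro h v ⟨hvC, hvB⟩
      by_contra hvball
      exact h v ⟨hvB, hvball⟩ hvC
  rw [this]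
  exact MeasurableSet.biInter (Set.to_countable _) fun v _ => (measurableSet_mem_openCluster x v).compl

/-- The containment events grow with the radius. [folklore] -/
theorem containedEvent_mono (x : V) (B : ℝ≥0∞) {r s : ℕ} (h : r ≤ s) :
    containedEvent G o x B r ⊆ containedEvent G o x B s :=
  fun _ hω => hω.trans (ballSet_mono x h)

/-- A light cluster is eventually contained: for `B ≠ 0`, `⋂_r ({light} ∖ containedEvent r) = ∅`
(the finitely many vertices of `C(x)` of weight `≥ B` lie in some ball). [cite: Timar2006, §4 (proof of Thm. 4.3: "the intersection of a light cluster with G(ℓ_{j+i}, ℓ_j] is finite by definition")] -/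
theorem iInter_light_diff_containedEvent (hconn : G.Connected) (x : V) {B : ℝ≥0∞} (hB : B ≠ 0) :
    ⋂ r : ℕ, ({ω : BondConfig V | ¬ IsHeavy G o (openCluster ω x)} \ containedEvent G o x B r) = ∅ := by
  refine Set.eq_empty_of_forall_notMem fun ω hω => ?_
  rw [Set.mem_iInter] at hω
  have hlight := (hω 0).1
  have hfin := finite_inter_of_not_isHeavy hlight hB
  -- each of the finitely many vertices lies in some ball, eventually in all balls
  have hev : ∀ᶠ r : ℕ in atTop, ∀ v ∈ openCluster ω x ∩ {v | B ≤ autWeight G o v},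
      v ∈ ballSet G x r := by
    rw [hfin.eventually_all]
    intro v _
    obtain ⟨p⟩ := hconn.preconnected x v
    exact eventually_atTop.2 ⟨p.length, fun r hr => mem_ballSet_iff.2 ⟨p, hr⟩⟩
  obtain ⟨r, hr⟩ := hev.exists
  exact (hω r).2 hr

/-- Hence **`P[light, not contained in B(x, r)] → 0`** as `r → ∞`. [cite: Timar2006, §4 (proof of Thm. 4.3: choice of r)] -/
theorem tendsto_measure_light_diff_containedEvent [Countable V] (hconn : G.Connected) (x : V)
    {B : ℝ≥0∞} (hB : B ≠ 0) (μ : Measure (BondConfig V)) [IsFiniteMeasure μ] :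
    Tendsto (fun r : ℕ => μ ({ω | ¬ IsHeavy G o (openCluster ω x)} \ containedEvent G o x B r))
      atTop (𝓝 0) := by
  have hmeas : ∀ r : ℕ, NullMeasurableSet
      ({ω : BondConfig V | ¬ IsHeavy G o (openCluster ω x)} \ containedEvent G o x B r) μ :=
    fun r => ((measurableSet_isHeavy_openCluster G o x).compl.diff
      (measurableSet_containedEvent x B r)).nullMeasurableSet
  have hanti : Antitone fun r : ℕ =>
      {ω : BondConfig V | ¬ IsHeavy G o (openCluster ω x)} \ containedEvent G o x B r :=
    fun r s hrs ω hω => ⟨hω.1, fun h => hω.2 (containedEvent_mono x B hrs h)⟩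
  have h := tendsto_measure_iInter_atTop hmeas hanti ⟨0, measure_ne_top μ _⟩
  rwa [iInter_light_diff_containedEvent hconn x hB, measure_empty] at h

/-! ### The uniform choice of `i` and `r` -/

/-- **"For any `k`, there exist an `i` and an `r ∈ ℕ` such that the open component of `o` in
`B_o(i; r)` is good with probability `> q/2` … Clearly, there is also a uniform choice"**, PROVED
in the form: for every `k` there are `I ≥ 1` and `r ≥ 1` such that
`P[F(o)] ≤ 2 · P[boxGood G o o o' a r k]` for EVERY threshold `a ∈ [Δ^{I+1}, Δ^I)` (the relative
thresholds met along the branching process), under Bernoulli(`p`) bond percolation with `p < 1` on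
a connected, locally finite, transitive nonunimodular graph, `o'` a neighbour of `o` of weight `Δ`.
[cite: Timar2006, §4 (proof of Thm. 4.3: choice of i and r; "Clearly, there is also a uniform choice")] -/
theorem exists_depth_radius_boxGood_ge [Countable V] (hconn : G.Connected)
    (htr : IsGraphTransitive G) (hU : ¬ IsGraphUnimodular G) {o' : V}
    (ho' : autWeight G o o' = minNbrWeight G o) {p : unitInterval} (hp1 : (p : ℝ) < 1) (k : ℕ) :
    ∃ I : ℕ, 1 ≤ I ∧ ∃ r : ℕ, 1 ≤ r ∧ ∀ a : ℝ≥0∞, minNbrWeight G o ^ (I + 1) ≤ a →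
      a < minNbrWeight G o ^ I →
        bondPercolation G p (niceEvent G o o o') ≤
          2 * bondPercolation G p (boxGood G o o o' a r k) := by
  set μ := bondPercolation G p with hμ
  set Δ := minNbrWeight G o with hΔ
  have hΔ0 : Δ ≠ 0 := minNbrWeight_ne_zero hconn o
  have hΔ1 : Δ < 1 := minNbrWeight_lt_one hconn htr hU o
  set q := μ (niceEvent G o o o') with hq
  by_cases hq0 : q = 0
  · exact ⟨1, le_rfl, 1, le_rfl, fun a _ _ => by rw [hq0]; exact zero_le⟩
  -- `ε = q/4`
  set ε := q / 2 / 2 with hε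
  have hqT : q ≠ ⊤ := measure_ne_top μ _
  have hε0 : 0 < ε := by
    rw [hε]
    exact ENNReal.div_pos (ENNReal.div_pos hq0 ENNReal.ofNat_ne_top).ne' ENNReal.ofNat_ne_top
  -- depth from the uniform Lemma 4.2
  obtain ⟨A₀, hA₀, hfew⟩ :=
    exists_forall_measure_windowFewEvent_le (o := o) hconn htr hU hp1 k hε0
  have hevI : ∀ᶠ n : ℕ in atTop, Δ ^ n < A₀ :=
    (tendsto_order.1 ((ENNReal.tendsto_pow_atTop_nhds_zero_iff).2 hΔ1)).2 A₀ hA₀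
  obtain ⟨I, hI1, hIA⟩ := ((eventually_ge_atTop 1).and hevI).exists
  -- radius from the containment of light clusters
  set B := Δ ^ (I + 1) with hB
  have hB0 : B ≠ 0 := pow_ne_zero _ hΔ0
  have htend := tendsto_measure_light_diff_containedEvent (o := o) hconn o hB0 μ
  obtain ⟨N, hN⟩ := (ENNReal.tendsto_atTop_zero.1 htend) ε hε0
  refine ⟨I, hI1, max N 1, le_max_right _ _, fun a haB haI => ?_⟩
  set r := max N 1 with hr
  have ha0 : 0 < a := lt_of_lt_of_le (pos_iff_ne_zero.2 hB0) haB
  have haA₀ : a ≤ A₀ := (haI.trans hIA).le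
  have ha1 : a < autWeight G o o := by
    rw [autWeight_self G hconn o]
    exact lt_of_lt_of_le haI (pow_le_one' hΔ1.le I)
  have ho'low : o' ∈ lowSet G o o := by
    show autWeight G o o' ≤ minNbrWeight G o * autWeight G o o
    rw [autWeight_self G hconn o, mul_one, ho']
  -- the inclusion `F ∩ (few)ᶜ ∩ contained ⊆ good`, almost surely
  have hωE : ∀ᵐ ω ∂μ, ω ⊆ G.edgeSet := ProbabilityTheory.setBernoulli_ae_subset
  have hincl : μ (niceEvent G o o o' ∩ (windowFewEvent G o a k)ᶜ ∩ containedEvent G o o B r) ≤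
      μ (boxGood G o o o' a r k) := by
    refine measure_mono_ae ?_
    filter_upwards [hωE] with ω hω hmem
    obtain ⟨⟨⟨hinf, hlight, hnice⟩, hnotfew⟩, hcont⟩ := hmem
    refine boxGood_of_nice hconn htr hU ho'low ha1 hω hnice ?_ ?_
    · intro v hv
      exact hcont ⟨hv.1, le_of_lt (lt_of_le_of_lt haB hv.2)⟩
    · have : ¬ (wregionCluster G o a ω ∩ wwindow G o a).encard < k := fun h =>
        hnotfew ⟨hinf, hlight, h⟩
      exact not_lt.1 this
  -- `q ≤ P[good] + ε + ε`
  have hsplit : q ≤ μ (boxGood G o o o' a r k) + ε + ε := by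
    have hsub : niceEvent G o o o' ⊆
        (niceEvent G o o o' ∩ (windowFewEvent G o a k)ᶜ ∩ containedEvent G o o B r) ∪
          windowFewEvent G o a k ∪
          ({ω | ¬ IsHeavy G o (openCluster ω o)} \ containedEvent G o o B r) := by
      intro ω hω
      by_cases h1 : ω ∈ windowFewEvent G o a k
      · exact Or.inl (Or.inr h1)
      by_cases h2 : ω ∈ containedEvent G o o B r
      · exact Or.inl (Or.inl ⟨⟨hω, h1⟩, h2⟩)
      · exact Or.inr ⟨hω.2.1, h2⟩
    calc q ≤ μ _ := measure_mono hsub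
      _ ≤ μ (niceEvent G o o o' ∩ (windowFewEvent G o a k)ᶜ ∩ containedEvent G o o B r) +
            μ (windowFewEvent G o a k) +
            μ ({ω | ¬ IsHeavy G o (openCluster ω o)} \ containedEvent G o o B r) :=
          (measure_union_le _ _).trans (by gcongr; exact measure_union_le _ _)
      _ ≤ μ (boxGood G o o o' a r k) + ε + ε := by
          gcongr
          · exact hfew a ha0 haA₀
          · exact hN r (le_max_left _ _)
  -- conclude `q ≤ 2 P[good]`
  have hεε : ε + ε = q / 2 := ENNReal.add_halves (q / 2)
  have hq2 : q / 2 + q / 2 = q := ENNReal.add_halves q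
  rw [add_assoc, hεε] at hsplit
  have hq2T : q / 2 ≠ ⊤ := ENNReal.div_ne_top hqT two_ne_zero
  have hhalf : q / 2 ≤ μ (boxGood G o o o' a r k) :=
    (ENNReal.add_le_add_iff_right hq2T).1 (hq2.le.trans hsplit)
  calc q = q / 2 + q / 2 := hq2.symm
    _ ≤ μ (boxGood G o o o' a r k) + μ (boxGood G o o o' a r k) := add_le_add hhalf hhalf
    _ = 2 * μ (boxGood G o o o' a r k) := (two_mul _).symm

end Nice

end Literature.Barriers.CriticalPhenomena

end
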